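import Mathlib
import HarnessLib
import Summits.NavierStokesRegularity.NavierStokesRegularity.Theorems.TaylorModelRungThreeVReadoutsWinDefs
import Summits.NavierStokesRegularity.NavierStokesRegularity.Theorems.TaylorModelRungThreeReadoutVTube

/-!
# Line `taylor-model` on crux K1b-DR (stmt-NavierStokesRegularity-23954) — G3-v part 1-W: κ-RESTART CHAINS along a
# polytope trajectory under the WINDOWED v3 certificate `ReadoutsVW` (ns-tm-g4 g6)

Port of `…ReadoutVTube`'s section `Tube` (`restart_first`, `restart_nodes`, `restart_tube`) to the windowed read-out
predicate `ReadoutsVW cd bx rd ro rw` (`…VReadoutsWinDefs`): the proofs are VERBATIM — they use only (R1) TUBE HULL, (R2) TUBE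
GROWTH, (R3) forward factors and (R4) window bounds, which `ReadoutsVW` carries at the same positions as `ReadoutsV` — and every
`hRO`-free helper (`gridV`, `Tn_succV`, `polyNode_*`, `inBox_hull2_of_hull1`, `one_le_L1V`, `kiter_congr`, …) is the landed one.
Names carry the suffix `W`.  Why a windowed predicate at all: see `…VReadoutsWinDefs` (the crossing read-outs (R8)–(R11) cannot
pass on the whole last sub-step's boxes; they are restated on emitted crossing windows).

MODEL-lattice rung TL-M3 only; nothing here is a statement about the Navier–Stokes equations.
-/

noncomputable section

-- the sub-problem namespace repeats the summit name by design (D-0017)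
set_option linter.dupNamespace false

namespace Summit.NavierStokesRegularity.NavierStokesRegularity.Theorems.TaylorModelV

open Set Finset
open Literature.Analysis.FluidPDE.TaoCascade Literature.Analysis.FluidPDE.TaoCascade.TaylorChain
open Summit.NavierStokesRegularity.NavierStokesRegularity.Theorems.TaylorModelMajorant
open Summit.NavierStokesRegularity.NavierStokesRegularity.Theorems.TaylorModelReadout

variable {cd : CertData} {bx : StepBoxes} {rd : RadiiData} {ro : ReadoutData} {rw : WinData} {φ : Flow}

section StageW

variable (hC : ChainVCore cd bx) {j : ℕ} (hj : j ≤ cd.N₀)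
include hC hj

/-- `Tn (s+1) = Tn s + h s`. -/
private theorem Tn_succV {s : ℕ} (hs : s < cd.S j) : cd.Tn j (s + 1) = cd.Tn j s + cd.h j s :=
  ((gridV hC hj).2.1 s hs).2

/-- `0 < h s`. -/
private theorem h_posV {s : ℕ} (hs : s < cd.S j) : 0 < cd.h j s := ((gridV hC hj).2.1 s hs).1

/-- `Tn s' ≤ Tn s` for `s' ≤ s ≤ S`. -/
private theorem Tn_le_TnV {s : ℕ} (hs : s ≤ cd.S j) {s' : ℕ} (hs' : s' ≤ s) : cd.Tn j s' ≤ cd.Tn j s :=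
  (gridV hC hj).2.2.1 s hs s' hs'

/-- `0 ≤ Tn s`. -/
private theorem Tn_nonnegV {s : ℕ} (hs : s ≤ cd.S j) : 0 ≤ cd.Tn j s := (gridV hC hj).2.2.2 s hs

end StageW

/-! ### κ-restarts -/

section Tube


/-- **First partial sub-step** of a κ-restart at time `t ∈ [Tn a, Tn (a+1)]`: by (F3′) the restart solves up to the
next node inside `B ⊕ BK ⊆ [−M, M]` ((R4)), and its node deviation lies in the K-box, `≤ L1 a·κ·ω`. [folklore] -/
theorem restart_firstW (hSN : cd.StageNumerics) (hC : ChainVCore cd bx) (hF : IsFlowPackageV cd bx φ)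
    (hRO : ReadoutsVW cd bx rd ro rw) {j : ℕ} (hj : j ≤ cd.N₀) (hwin : -cd.Kb ≤ cd.Ka)
    {q : Fin 4 → ℤ → ℝ} (hq : SolvesOn cd φ j q (cd.Tn j (cd.S j)))
    (hqN : ∀ s, s ≤ cd.S j → InBox cd (bx.hlo 1 j s) (bx.hhi 1 j s) (stAt φ j q (cd.Tn j s)))
    {a : ℕ} (ha : a < cd.S j) {t : ℝ} (ht : t ∈ Icc (cd.Tn j a) (cd.Tn j (a + 1)))
    {z : Fin 4 → ℤ → ℝ} (hz : cd.InBall j (z - stAt φ j q t) (cd.κ j)) :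
    SolvesOn cd φ j z (cd.Tn j (a + 1) - t) ∧
      (∀ t' ∈ Icc 0 (cd.Tn j (a + 1) - t), ∀ i k, -cd.Kb ≤ k → k ≤ cd.Ka → |φ j z i k t'| ≤ cd.M k) ∧
      cd.InBall j (stAt φ j z (cd.Tn j (a + 1) - t) - stAt φ j q (cd.Tn j (a + 1))) (cd.L1 j a * cd.κ j) := by
  have _ := hSN; have _ := hwin
  obtain ⟨-, -, -, -, -, -, -, -, -, hR4, -⟩ := hRO j hj
  obtain ⟨hw, hwB⟩ := polyNode_solves_inBox hC hF hj hq ha (hqN a ha.le)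
  have hTa1 := Tn_succV hC hj ha
  have hu₀ : t - cd.Tn j a ∈ Icc 0 (cd.h j a) := ⟨by linarith [ht.1], by linarith [ht.2]⟩
  have hqt : stAt φ j q t = stAt φ j (stAt φ j q (cd.Tn j a)) (t - cd.Tn j a) :=
    (polyNode_shift hC hF hj hq ha.le).2 t ⟨ht.1, ht.2.trans (Tn_le_TnV hC hj le_rfl (Nat.succ_le_of_lt ha))⟩
  rw [hqt] at hz
  obtain ⟨hF3, -⟩ := ((hF.2 j hj).2.2 a ha).2
  obtain ⟨hsol, hdiff⟩ := hF3 _ _ hu₀ hw hwB z hz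
  have eT : cd.h j a - (t - cd.Tn j a) = cd.Tn j (a + 1) - t := by rw [hTa1]; ring
  rw [eT] at hsol hdiff
  obtain ⟨-, -, -, -, hK0, -, hKrow, -⟩ := (hC j hj).2.2.2 a ha
  refine ⟨hsol, fun t' ht' i k hk1 hk2 => ?_, fun i k hk1 hk2 => ?_⟩
  · have hmem : t - cd.Tn j a + t' ∈ Icc 0 (cd.h j a) :=
      ⟨by linarith [hu₀.1, ht'.1], by rw [hTa1] at ht'; linarith [ht'.2]⟩
    have hB := hwB _ hmem i k hk1 hk2
    have hK := hdiff t' ht' i k hk1 hk2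
    have h4 := hR4 a ha i k hk1 hk2
    simp only [Pi.sub_apply] at hK
    have e : φ j z i k t' = stAt φ j z t' i k := rfl
    rw [e, abs_le]
    constructor <;> linarith [hK.1, hK.2, hB.1, hB.2, h4.1, h4.2.1]
  · have hmemh : cd.Tn j (a + 1) - t ∈ Icc 0 (cd.Tn j (a + 1) - t) := ⟨by linarith [ht.2], le_rfl⟩
    have hK := hdiff _ hmemh i k hk1 hk2
    have e1 : t - cd.Tn j a + (cd.Tn j (a + 1) - t) = cd.h j a := by rw [hTa1]; ring
    rw [e1, ← polyNode_succ hC hF hj hq ha] at hK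
    have hrow := hKrow i k hk1 hk2
    have hlo : |bx.loK j a i k| ≤ cd.L1 j a * cd.κ j * cd.ω j k := (le_max_left _ _).trans hrow
    have hhi : |bx.hiK j a i k| ≤ cd.L1 j a * cd.κ j * cd.ω j k := (le_max_right _ _).trans hrow
    rw [mul_assoc] at hlo hhi
    rw [abs_le]
    constructor
    · linarith [hK.1, neg_abs_le (bx.loK j a i k)]
    · linarith [hK.2, le_abs_self (bx.hiK j a i k)]

/-- **κ-restart through the nodes.** For a restart at `t ∈ [Tn a, Tn (a+1)]` and every later node `b = a+1+n ≤ S`: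
`φ j z` solves on `[0, Tn b − t]` with the window bounds; its deviation from the polytope node is (on the window) a
chain of real kernels `A s' ∈ [Mlo s', Mhi s']`, `a+1 ≤ s' < b`, applied to the first-node deviation — hence
`≤ ΛT·κ·ω` by (R2)(R3) — and its node state lies in the outer hull `H²_b` by (R1). [folklore] -/
theorem restart_nodesW (hSN : cd.StageNumerics) (hC : ChainVCore cd bx) (hF : IsFlowPackageV cd bx φ)
    (hRO : ReadoutsVW cd bx rd ro rw) {j : ℕ} (hj : j ≤ cd.N₀) (hwin : -cd.Kb ≤ cd.Ka)
    {q : Fin 4 → ℤ → ℝ} (hq : SolvesOn cd φ j q (cd.Tn j (cd.S j)))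
    (hqN : ∀ s, s ≤ cd.S j → InBox cd (bx.hlo 1 j s) (bx.hhi 1 j s) (stAt φ j q (cd.Tn j s)))
    {a : ℕ} (ha : a < cd.S j) {t : ℝ} (ht : t ∈ Icc (cd.Tn j a) (cd.Tn j (a + 1)))
    {z : Fin 4 → ℤ → ℝ} (hz : cd.InBall j (z - stAt φ j q t) (cd.κ j)) :
    ∀ n : ℕ, a + 1 + n ≤ cd.S j →
      SolvesOn cd φ j z (cd.Tn j (a + 1 + n) - t) ∧
      (∀ t' ∈ Icc 0 (cd.Tn j (a + 1 + n) - t), ∀ i k, -cd.Kb ≤ k → k ≤ cd.Ka → |φ j z i k t'| ≤ cd.M k) ∧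
      (∃ A : ℕ → Ker, (∀ s', a + 1 ≤ s' → s' < a + 1 + n → KerMem cd (A s') (bx.Mlo j s') (bx.Mhi j s')) ∧
        ∀ i k, -cd.Kb ≤ k → k ≤ cd.Ka →
          (stAt φ j z (cd.Tn j (a + 1 + n) - t) - stAt φ j q (cd.Tn j (a + 1 + n))) i k =
            kiter cd A (a + 1) n (stAt φ j z (cd.Tn j (a + 1) - t) - stAt φ j q (cd.Tn j (a + 1))) i k) ∧
      cd.InBall j (stAt φ j z (cd.Tn j (a + 1 + n) - t) - stAt φ j q (cd.Tn j (a + 1 + n))) (ro.ΛT j * cd.κ j) ∧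
      InBox cd (bx.hlo 2 j (a + 1 + n)) (bx.hhi 2 j (a + 1 + n)) (stAt φ j z (cd.Tn j (a + 1 + n) - t)) := by
  have hω : ∀ k, 0 < cd.ω j k := (hSN.1 j hj).2.2.2.2.2.2.1
  have hκ : 0 ≤ cd.κ j := le_of_lt (hSN.1 j hj).2.2.2.1
  obtain ⟨-, -, -, -, -, hR1, hR2, hR3, -, hR4, -⟩ := hRO j hj
  obtain ⟨hsol₁, hbd₁, hdev₁⟩ := restart_firstW hSN hC hF hRO hj hwin hq hqN ha ht hz
  have hU := isUniqueFlow_of_packageV hF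
  have hL1a : 0 ≤ cd.L1 j a := (one_le_L1V hC hj hω hwin ha).2
  set d₁ := stAt φ j z (cd.Tn j (a + 1) - t) - stAt φ j q (cd.Tn j (a + 1)) with hd₁
  -- from a kernel chain to the `ΛT·κ` deviation bound and the outer-hull membership
  have hclose : ∀ n, a + 1 + n ≤ cd.S j → ∀ A : ℕ → Ker,
      (∀ s', a + 1 ≤ s' → s' < a + 1 + n → KerMem cd (A s') (bx.Mlo j s') (bx.Mhi j s')) →
      (∀ i k, -cd.Kb ≤ k → k ≤ cd.Ka →
        (stAt φ j z (cd.Tn j (a + 1 + n) - t) - stAt φ j q (cd.Tn j (a + 1 + n))) i k = kiter cd A (a + 1) n d₁ i k) →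
      cd.InBall j (stAt φ j z (cd.Tn j (a + 1 + n) - t) - stAt φ j q (cd.Tn j (a + 1 + n))) (ro.ΛT j * cd.κ j) ∧
      InBox cd (bx.hlo 2 j (a + 1 + n)) (bx.hhi 2 j (a + 1 + n)) (stAt φ j z (cd.Tn j (a + 1 + n) - t)) := by
    intro n hn A hA heq
    have h2 := hR2 (a + 1) (a + 1 + n) (Nat.le_add_right _ _) hn A hA d₁ _ (mul_nonneg hL1a hκ) hdev₁
    rw [Nat.add_sub_cancel_left] at h2
    have h3 : cd.InBall j (stAt φ j z (cd.Tn j (a + 1 + n) - t) - stAt φ j q (cd.Tn j (a + 1 + n)))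
        (ro.ΛT j * cd.κ j) := by
      refine G3.inBall_mono hω (inBall_of_window_eq heq h2) ?_
      have h4 := (hR3 a (a + 1 + n) ha (Nat.le_add_right _ _) hn).1
      nlinarith [h4, hκ]
    refine ⟨h3, ?_⟩
    have e : stAt φ j z (cd.Tn j (a + 1 + n) - t) =
        stAt φ j q (cd.Tn j (a + 1 + n)) +
          (stAt φ j z (cd.Tn j (a + 1 + n) - t) - stAt φ j q (cd.Tn j (a + 1 + n))) := (add_sub_cancel _ _).symm
    rw [e]
    exact hR1 _ hn _ _ (hqN _ hn) h3
  intro n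
  induction n with
  | zero =>
    intro hn
    simp only [Nat.add_zero] at hn ⊢
    have hA0 : ∀ s', a + 1 ≤ s' → s' < a + 1 →
        KerMem cd ((fun _ => fun _ _ _ _ => (0:ℝ)) s') (bx.Mlo j s') (bx.Mhi j s') :=
      fun s' h1 h2 => absurd h2 (not_lt.2 h1)
    have heq0 : ∀ i k, -cd.Kb ≤ k → k ≤ cd.Ka →
        (stAt φ j z (cd.Tn j (a + 1) - t) - stAt φ j q (cd.Tn j (a + 1))) i k =
          kiter cd (fun _ => fun _ _ _ _ => (0:ℝ)) (a + 1) 0 d₁ i k := fun i k _ _ => rfl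
    have hc := hclose 0 (by simpa using hn) _ hA0 (by simpa using heq0)
    simp only [Nat.add_zero] at hc
    exact ⟨hsol₁, hbd₁, ⟨_, hA0, heq0⟩, hc.1, hc.2⟩
  | succ n IH =>
    intro hn
    have eb : a + 1 + (n + 1) = a + 1 + n + 1 := rfl
    rw [eb] at hn ⊢
    have hb : a + 1 + n < cd.S j := Nat.lt_of_succ_le hn
    obtain ⟨hsolb, hbdb, ⟨A, hA, heq⟩, -, hH2b⟩ := IH hb.le
    -- (F1′) at the restart's node state (∈ H²)
    obtain ⟨hsolm, hBm⟩ := ((hF.2 j hj).2.2 _ hb).1 _ hH2b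
    have ht0 : 0 ≤ cd.Tn j (a + 1 + n) - t := by
      have := Tn_le_TnV hC hj hb.le (Nat.le_add_right (a + 1) n)
      linarith [ht.2]
    have hTb := Tn_succV hC hj hb
    obtain ⟨hsol', happ⟩ := solvesOn_appendU hU hj ht0 (h_posV hC hj hb).le hsolb hsolm
    have eT : cd.Tn j (a + 1 + n) - t + cd.h j (a + 1 + n) = cd.Tn j (a + 1 + n + 1) - t := by rw [hTb]; ring
    rw [eT] at hsol' happ
    -- the next node states
    have hm' : stAt φ j z (cd.Tn j (a + 1 + n + 1) - t) =
        stAt φ j (stAt φ j z (cd.Tn j (a + 1 + n) - t)) (cd.h j (a + 1 + n)) := by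
      have h1 := happ (cd.Tn j (a + 1 + n + 1) - t) ⟨by rw [hTb]; linarith [h_posV hC hj hb], le_rfl⟩
      rw [h1]; congr 1; rw [hTb]; ring
    have hn' := polyNode_succ hC hF hj hq hb
    -- (F8′) between the two node states
    obtain ⟨Ab, hAbM, hAbeq⟩ := ((hF.2 j hj).2.2 _ hb).2.2.2.2.2 _ _ hH2b
      (inBox_hull2_of_hull1 hC hj hb.le (hqN _ hb.le))
    obtain ⟨-, -, -, -, hK0, -⟩ := (hC j hj).2.2.2 _ hb
    refine ⟨hsol', fun t' ht' i k hk1 hk2 => ?_, ?_⟩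
    · -- window bounds on the extended horizon
      by_cases hle : t' ≤ cd.Tn j (a + 1 + n) - t
      · exact hbdb t' ⟨ht'.1, hle⟩ i k hk1 hk2
      · have hlt := lt_of_not_ge hle
        have h1 := happ t' ⟨hlt.le, ht'.2⟩
        have hu : t' - (cd.Tn j (a + 1 + n) - t) ∈ Icc 0 (cd.h j (a + 1 + n)) :=
          ⟨by linarith, by rw [hTb] at ht'; linarith [ht'.2]⟩
        have hB := hBm _ hu i k hk1 hk2
        have h4 := hR4 _ hb i k hk1 hk2
        have h5 := hK0 i k hk1 hk2
        have e : φ j z i k t' = stAt φ j z t' i k := rfl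
        rw [e, h1, abs_le]
        constructor <;> linarith [hB.1, hB.2, h4.1, h4.2.1, h5.1, h5.2.1]
    · -- the extended kernel chain
      classical
      obtain ⟨A', hA'⟩ : ∃ A' : ℕ → Ker, ∀ s, A' s = if s = a + 1 + n then Ab else A s :=
        ⟨fun s => if s = a + 1 + n then Ab else A s, fun _ => rfl⟩
      have hA'M : ∀ s', a + 1 ≤ s' → s' < a + 1 + n + 1 → KerMem cd (A' s') (bx.Mlo j s') (bx.Mhi j s') := by
        intro s' h1 h2
        rcases Nat.lt_succ_iff_lt_or_eq.1 h2 with hlt | heq'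
        · rw [hA', if_neg (Nat.ne_of_lt hlt)]; exact hA s' h1 hlt
        · rw [hA', heq', if_pos rfl]; exact hAbM
      have heq' : ∀ i k, -cd.Kb ≤ k → k ≤ cd.Ka →
          (stAt φ j z (cd.Tn j (a + 1 + n + 1) - t) - stAt φ j q (cd.Tn j (a + 1 + n + 1))) i k =
            kiter cd A' (a + 1) (n + 1) d₁ i k := by
        intro i k hk1 hk2
        have hk : -cd.Kb ≤ k ∧ k ≤ cd.Ka := ⟨hk1, hk2⟩
        have h1 : (stAt φ j z (cd.Tn j (a + 1 + n + 1) - t) - stAt φ j q (cd.Tn j (a + 1 + n + 1))) i k =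
            kapp cd Ab (stAt φ j z (cd.Tn j (a + 1 + n) - t) - stAt φ j q (cd.Tn j (a + 1 + n))) i k := by
          rw [hm', hn', kapp, if_pos hk]
          exact hAbeq i k hk1 hk2
        have h2 : kiter cd A' (a + 1) (n + 1) d₁ = kapp cd (A' (a + 1 + n)) (kiter cd A' (a + 1) n d₁) := rfl
        have h3 : A' (a + 1 + n) = Ab := by rw [hA', if_pos rfl]
        have h4 : kiter cd A' (a + 1) n d₁ = kiter cd A (a + 1) n d₁ :=
          (kiter_congr (fun m hm => by rw [hA', if_neg (by omega)]) d₁).symm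
        rw [h1, h2, h3, h4, kapp_congr Ab heq]
      have hc := hclose (n + 1) hn A' hA'M heq'
      exact ⟨⟨A', hA'M, heq'⟩, hc.1, hc.2⟩

/-- **κ-TUBE (existence and window bounds)**: a state `κ_j·ω`-close to the polytope trajectory at any time
`t ∈ [0, Tn S]` is carried to the end of the stage with the window bounds — the existence/bounds half of K1b-DR's
κ-tube clause. [folklore] -/
theorem restart_tubeW (hSN : cd.StageNumerics) (hC : ChainVCore cd bx) (hF : IsFlowPackageV cd bx φ)
    (hRO : ReadoutsVW cd bx rd ro rw) {j : ℕ} (hj : j ≤ cd.N₀) (hwin : -cd.Kb ≤ cd.Ka)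
    {q : Fin 4 → ℤ → ℝ} (hq : SolvesOn cd φ j q (cd.Tn j (cd.S j)))
    (hqN : ∀ s, s ≤ cd.S j → InBox cd (bx.hlo 1 j s) (bx.hhi 1 j s) (stAt φ j q (cd.Tn j s)))
    {t : ℝ} (ht : t ∈ Icc 0 (cd.Tn j (cd.S j)))
    {z : Fin 4 → ℤ → ℝ} (hz : cd.InBall j (z - stAt φ j q t) (cd.κ j)) :
    SolvesOn cd φ j z (cd.Tn j (cd.S j) - t) ∧
      ∀ t' ∈ Icc 0 (cd.Tn j (cd.S j) - t), ∀ i k, -cd.Kb ≤ k → k ≤ cd.Ka → |φ j z i k t'| ≤ cd.M k := by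
  have hS : 0 < cd.S j := (hC j hj).1
  have h0 : cd.Tn j 0 ≤ t := by rw [(hC j hj).2.1]; exact ht.1
  obtain ⟨a, -, ha, hta, hta1⟩ := G3.exists_substep (cd := cd) (j := j) hS h0 ht.2
  have hn : a + 1 + (cd.S j - (a + 1)) = cd.S j := Nat.add_sub_cancel' (Nat.succ_le_of_lt ha)
  have h := restart_nodesW hSN hC hF hRO hj hwin hq hqN ha ⟨hta, hta1⟩ hz (cd.S j - (a + 1)) (le_of_eq hn)
  rw [hn] at h
  exact ⟨h.1, h.2.1⟩

end Tube

end Summit.NavierStokesRegularity.NavierStokesRegularity.Theorems.TaylorModelV
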